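import Mathlib.RingTheory.PiTensorProduct
import Mathlib.LinearAlgebra.Complex.Module
import Mathlib.Analysis.InnerProductSpace.Basic
import Mathlib.Analysis.Complex.Isometry
import Mathlib.Algebra.Algebra.Pi
import Mathlib.Algebra.BigOperators.Ring.Finset
import HarnessLib

/-!
# [IUTchIV] Proposition 1.5 (iii), (iv): direct sums and tensor products of multiple copies of `ℂ`

Mochizuki, *Inter-universal Teichmüller theory IV: log-volume computations and set-theoretic
foundations*, RIMS manuscript (Apr. 2020; = PRIMS **57** (2021)), §1, Proposition 1.5 "(Archimedean
Metric Estimates)" (iii) "(Direct Sums and Tensor Products of Multiple Copies)" pp. 15–16 and (iv)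
"(Tensor Product of Vectors of a Given Length)" p. 16 (kurims `paper:url-56bcb0f95768`, read on the
page). Parts (i), (ii) (`ℂ ⊗_ℝ ℂ ≅ ℂ ⊕ ℂ` versus metrics and the primitive automorphisms) are the sibling
module `Literature.IUT.LogVolume.ArchimedeanMetrics` (`Prop15.crt`, `Prop15.norm_sq_crt`); the content
is classical finite-dimensional algebra over `ℝ`; the series' bibliographic key carries the D-0012
claim status, hence the tag form. Nothing here takes a side on [IUTchIII] Cor. 3.12; typed ≠ discharged.

REAL DEFINITIONS (Mathlib):
* `M V = ⊕_{v∈V} ℂ_v` is the product `ℝ`-algebra `V → ℂ` with the direct sum metric `dsInner`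
  (`Σ_v ⟪·,·⟫_ℝ`, Mathlib's real inner product `⟪w, z⟫_ℝ = Re(z·w̄)` on `ℂ`);
* `MI I V = M_I = ⊗_{i∈I} M_i` is Mathlib's `PiTensorProduct` over `ℝ`, with the commutative
  `ℝ`-algebra structure induced by the ring structures of the `ℂ_v` (`PiTensorProduct.instCommRing`) —
  "the topological ring structure on each `ℂ_v` determines a topological ring structure on `M_I`" (the
  topology, the canonical one of a finite-dimensional real vector space, is not modelled);
* a "direct sum decomposition [of `M_I`] as a direct sum of copies of `ℂ`" indexed by a finite set `J` is
  an `ℝ`-algebra isomorphism `Φ : M_I ≅ ⊕_{j∈J} ℂ` (`Decomposition I V J`); its "direct sum metric" is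
  `dsNormSq Φ x = Σ_j |Φ x j|²` and its "integral structure" is `ball Φ = {x | ∀ j, |Φ x j| ≤ 1} = B_I`;
* "the tensor product metric" on `M_I` is any (the) bilinear form `B` with
  `B(⊗ m_i, ⊗ m'_i) = ∏_i ⟪m_i, m'_i⟫` (`IsTensorMetric`);
* "the primitive automorphisms of `ℂ`" (the group of order 8 generated by conjugation and `±1`, `±√−1`,
  p. 14) = `IsPrimitive`; the automorphism of `M_I` induced by primitive automorphisms `σ_{i,v}` of the
  summands `ℂ_v` of the factors `M_i` = `induced I V σ` (`PiTensorProduct.map`);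
* the `2^{|I|−1}·|V|^{|I|}` copies of `ℂ` are indexed by the characters `χ_{w,ε} : M_I → ℂ`,
  `⊗ m_i ↦ ∏_i cj(ε_i)(m_i(w_i))` (`character`), `w ∈ V^I`, `ε ∈ {id, conj}^I` up to a global conjugation.

NAMED STATEMENTS (one per printed assertion): `Prop15iii_decomposition` (existence of a decomposition
into `2^{|I|−1}·|V|^{|I|}` copies), `Prop15iii_unique` ("unique"), `Prop15iii_metric` (direct sum metric
`= 2^{|I|−1} ×` tensor product metric), `Prop15iii_preserved` (invariance under the induced primitive
automorphisms), `Prop15iv`.  PROOFS are in the proof-only companions `ArchimedeanTensorCopiesProofs*`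
(characters of `M_I`, `Prop15iv`, the count for every decomposition, uniqueness; then existence, the
metric comparison and invariance).  Degenerate instances: the text assumes `I, V ≠ ∅`; for `I = ∅`
(`M_I = ℝ`) no decomposition into copies of `ℂ` exists, so `Prop15iii_decomposition` carries
`[Nonempty I]` and the other statements are vacuous there; `V = ∅` is harmless (`M_I = 0`, no copies).
-/

noncomputable section

namespace Literature.IUT.LogVolume

namespace Prop15iii

open scoped TensorProduct ComplexConjugate
open Complex PiTensorProduct

variable (I V : Type) [Fintype I]

/-- `M := ⊕_{v ∈ V} ℂ_v`, "the direct sum of copies `ℂ_v := ℂ` of `ℂ` labeled by `v ∈ V`", as the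
product `ℝ`-algebra `V → ℂ` (Prop. 1.5 (iii), p. 15). [claim: Mochizuki2012, status: disputed] -/
abbrev M : Type := V → ℂ

/-- The direct sum metric on `M = ⊕_v ℂ_v` (real part of the standard Hermitian metric, summed over
`v`): `⟪m, m'⟫ := Σ_v ⟪m_v, m'_v⟫_ℝ` (p. 15: "which we regard as equipped with the direct sum metric").
[claim: Mochizuki2012, status: disputed] -/
def dsInner [Fintype V] (m m' : M V) : ℝ := ∑ v, inner ℝ (m v) (m' v)

/-- `M_I := ⊗_{i ∈ I} M_i`, "the tensor product over `ℝ` of copies `M_i := M` of `M` labeled by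
`i ∈ I`" (p. 15), as Mathlib's `PiTensorProduct`; it carries the `ℝ`-algebra structure induced by the
ring structures of the `ℂ_v` ("the topological ring structure on each `ℂ_v` determines a topological
ring structure on `M_I`", p. 15; `PiTensorProduct.instCommRing`). [claim: Mochizuki2012, status: disputed] -/
abbrev MI : Type := ⨂[ℝ] _ : I, M V

/-! ## The characters of `M_I` (the copies of `ℂ` in the direct sum decomposition) -/

/-- `cj b` is complex conjugation if `b = true` and the identity otherwise, as an `ℝ`-algebra
endomorphism of `ℂ` ("complex conjugation", Prop. 1.5, p. 14). [claim: Mochizuki2012, status: disputed] -/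
def cj (b : Bool) : ℂ →ₐ[ℝ] ℂ := if b then conjAe else AlgHom.id ℝ ℂ

/-- `cj false = id` (p. 14). [claim: Mochizuki2012, status: disputed] -/
@[simp] theorem cj_false (z : ℂ) : cj false z = z := rfl

/-- `cj true = conj` (p. 14). [claim: Mochizuki2012, status: disputed] -/
@[simp] theorem cj_true (z : ℂ) : cj true z = conj z := rfl

/-- `‖cj b z‖ = ‖z‖`: the primitive automorphisms are isometries (p. 14). [claim: Mochizuki2012, status: disputed] -/
@[simp] theorem norm_cj (b : Bool) (z : ℂ) : ‖cj b z‖ = ‖z‖ := by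
  cases b <;> simp

/-- Every `ℝ`-algebra endomorphism of `ℂ` is `cj b` for some `b` (Mathlib:
`Complex.real_algHom_eq_id_or_conj`; used for the "unique" of Prop. 1.5 (iii), p. 15). [claim: Mochizuki2012, status: disputed] -/
theorem exists_eq_cj (f : ℂ →ₐ[ℝ] ℂ) : ∃ b : Bool, f = cj b := by
  rcases Complex.real_algHom_eq_id_or_conj f with h | h
  · exact ⟨false, h⟩
  · exact ⟨true, h⟩

/-- The multilinear map `(m_i)_i ↦ ∏_i cj(ε_i)(m_i(w_i))` underlying the character of `M_I` attached to
`w : I → V`, `ε : I → Bool`. [claim: Mochizuki2012, status: disputed] -/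
def charMultilinear (w : I → V) (ε : I → Bool) : MultilinearMap ℝ (fun _ : I => M V) ℂ :=
  (MultilinearMap.mkPiAlgebra ℝ I ℂ).compLinearMap
    fun i => (cj (ε i)).toLinearMap ∘ₗ (LinearMap.proj (w i) : (V → ℂ) →ₗ[ℝ] ℂ)

/-- Unfolding `charMultilinear`. [claim: Mochizuki2012, status: disputed] -/
@[simp] theorem charMultilinear_apply (w : I → V) (ε : I → Bool) (m : I → M V) :
    charMultilinear I V w ε m = ∏ i, cj (ε i) (m i (w i)) := by
  simp [charMultilinear, MultilinearMap.mkPiAlgebra_apply]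

/-- The character `χ_{w,ε} : M_I → ℂ`, `⊗_i m_i ↦ ∏_i cj(ε_i)(m_i(w_i))`, an `ℝ`-algebra homomorphism
(a coordinate of the direct sum decomposition of (iii)). [claim: Mochizuki2012, status: disputed] -/
def character (w : I → V) (ε : I → Bool) : MI I V →ₐ[ℝ] ℂ :=
  liftAlgHom (charMultilinear I V w ε)
    (by simp)
    (fun x y => by simp [Finset.prod_mul_distrib])

/-- `χ_{w,ε}(⊗_i m_i) = ∏_i cj(ε_i)(m_i(w_i))`. [claim: Mochizuki2012, status: disputed] -/
@[simp] theorem character_tprod (w : I → V) (ε : I → Bool) (m : I → M V) :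
    character I V w ε (tprod ℝ m) = ∏ i, cj (ε i) (m i (w i)) := by
  simp [character]

/-! ## Direct sum decompositions of `M_I` into copies of `ℂ`; the integral structure `B_I` -/

/-- "`M_I` admits a unique direct sum decomposition as a direct sum of … copies of `ℂ`" (p. 15): a direct
sum decomposition of the (commutative) topological ring `M_I` into copies of `ℂ`, indexed by a finite
set `J`, is an isomorphism of `ℝ`-algebras `M_I ≅ ⊕_{j ∈ J} ℂ`. [claim: Mochizuki2012, status: disputed] -/
abbrev Decomposition (J : Type) : Type := MI I V ≃ₐ[ℝ] (J → ℂ)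

variable {I V}

/-- "The direct sum metric on `M_I`, i.e., the metric determined by the natural metrics on these copies
of `ℂ`" (p. 15), as the quadratic form `x ↦ Σ_j |x_j|²` of a decomposition.
[claim: Mochizuki2012, status: disputed] -/
def dsNormSq {J : Type} [Fintype J] (Φ : Decomposition I V J) (x : MI I V) : ℝ := ∑ j, ‖Φ x j‖ ^ 2

/-- `B_I ⊆ M_I`, "the 'integral structure' … given by the direct product of the unit balls of the copies
of `ℂ` that occur in the direct sum decomposition of `M_I`" (p. 15). [claim: Mochizuki2012, status: disputed] -/
def ball {J : Type} (Φ : Decomposition I V J) : Set (MI I V) := {x | ∀ j, ‖Φ x j‖ ≤ 1}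

variable (I V)

/-- "The tensor product metric" on `M_I = ⊗_i M_i` (p. 15; cf. [IUTchIII] Prop. 3.2 (ii)): a bilinear
form `B` on `M_I` with `B(⊗_i m_i, ⊗_i m'_i) = ∏_i ⟪m_i, m'_i⟫` (such a form is unique, pure tensors
spanning `M_I`). [claim: Mochizuki2012, status: disputed] -/
def IsTensorMetric [Fintype V] (B : MI I V →ₗ[ℝ] MI I V →ₗ[ℝ] ℝ) : Prop :=
  ∀ m m' : I → M V, B (tprod ℝ m) (tprod ℝ m') = ∏ i, dsInner V (m i) (m' i)

/-! ## Primitive automorphisms and the automorphisms of `M_I` they induce -/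

/-- "The primitive automorphisms of `ℂ`": "the group of automorphisms [of order 8] of the underlying
metrized real vector space of `ℂ` generated by the operations of complex conjugation and multiplication by
`±1` or `±√−1`" (p. 14), i.e. `z ↦ u·z` or `z ↦ u·z̄` with `u⁴ = 1`, as a predicate on `ℝ`-linear
isometries of `ℂ`. [claim: Mochizuki2012, status: disputed] -/
def IsPrimitive (σ : ℂ ≃ₗᵢ[ℝ] ℂ) : Prop :=
  ∃ u : ℂ, u ^ 4 = 1 ∧ ((∀ z, σ z = u * z) ∨ ∀ z, σ z = u * conj z)

/-- A family `τ = (τ_v)_{v∈V}` of automorphisms of the summands `ℂ_v` acting on `M = ⊕_v ℂ_v`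
summand-wise. [claim: Mochizuki2012, status: disputed] -/
def onSummands (τ : V → (ℂ ≃ₗᵢ[ℝ] ℂ)) : M V →ₗ[ℝ] M V :=
  LinearMap.pi fun v => (τ v).toLinearEquiv.toLinearMap ∘ₗ LinearMap.proj v

/-- Unfolding `onSummands`. [claim: Mochizuki2012, status: disputed] -/
@[simp] theorem onSummands_apply (τ : V → (ℂ ≃ₗᵢ[ℝ] ℂ)) (m : M V) (v : V) :
    onSummands V τ m v = τ v (m v) := rfl

/-- "The automorphisms of `M_I` induced by the various primitive automorphisms of the direct summands
`ℂ_v` that appear in the factors `M_i` of the tensor product `M_I`" (p. 16): the endomorphism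
`⊗_i (⊕_v σ_{i,v})` of `M_I` induced by a family `σ = (σ_{i,v})`. [claim: Mochizuki2012, status: disputed] -/
def induced (σ : I → V → (ℂ ≃ₗᵢ[ℝ] ℂ)) : MI I V →ₗ[ℝ] MI I V :=
  PiTensorProduct.map fun i => onSummands V (σ i)

omit [Fintype I] in
/-- `induced σ (⊗_i m_i) = ⊗_i (σ_{i,v}(m_{i,v}))_v`. [claim: Mochizuki2012, status: disputed] -/
@[simp] theorem induced_tprod (σ : I → V → (ℂ ≃ₗᵢ[ℝ] ℂ)) (m : I → M V) :
    induced I V σ (tprod ℝ m) = tprod ℝ fun i => onSummands V (σ i) (m i) :=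
  PiTensorProduct.map_tprod _ _

variable {I V} in
/-- "Preserves the direct sum decomposition of `M_I`": an endomorphism `F` of `M_I` permutes the copies
of `ℂ` of a decomposition `Φ`, acting on each through an isometry of `ℂ`. [claim: Mochizuki2012, status: disputed] -/
def PreservesDecomposition {J : Type} (Φ : Decomposition I V J) (F : MI I V →ₗ[ℝ] MI I V) : Prop :=
  ∃ (e : J ≃ J) (u : J → (ℂ ≃ₗᵢ[ℝ] ℂ)), ∀ x j, Φ (F x) (e j) = u j (Φ x j)

/-! ## The statements of Proposition 1.5 (iii), (iv) -/

/-- **[IUTchIV] Prop. 1.5 (iii), first assertion (existence and number of copies)**: "the topological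
ring structure on each `ℂ_v` determines a topological ring structure on `M_I` with respect to which `M_I`
admits a [unique] direct sum decomposition as a direct sum of `2^{|I|−1}·|V|^{|I|}` copies of `ℂ`
[cf. [IUTchIII], Proposition 3.1, (i)]" (p. 15). Named statement (uniqueness: `Prop15iii_unique`; the
count for EVERY decomposition is proved below, `card_eq_of_decomposition`).
[claim: Mochizuki2012, status: disputed] -/
def Prop15iii_decomposition [Fintype V] [Nonempty I] : Prop :=
  ∃ (J : Type) (_ : Fintype J), Nonempty (Decomposition I V J) ∧
    Fintype.card J = 2 ^ (Fintype.card I - 1) * Fintype.card V ^ Fintype.card I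

/-- **[IUTchIV] Prop. 1.5 (iii), "unique"**: any two direct sum decompositions of `M_I` into copies of
`ℂ` differ by a bijection of the index sets and, on each copy, the identity or complex conjugation
(p. 15). [claim: Mochizuki2012, status: disputed] -/
def Prop15iii_unique : Prop :=
  ∀ (J J' : Type) [Fintype J] [DecidableEq J] [Fintype J'] [DecidableEq J']
    (Φ : Decomposition I V J) (Φ' : Decomposition I V J'),
    ∃ (e : J ≃ J') (c : J → Bool), ∀ x j, Φ' x (e j) = cj (c j) (Φ x j)

/-- **[IUTchIV] Prop. 1.5 (iii), metrics**: "The direct sum metric on `M_I` — i.e., the metric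
determined by the natural metrics on these copies of `ℂ` — is equal to `2^{|I|−1}` times the original
tensor product metric on `M_I`" (p. 15; "metric" = the Hermitian/quadratic form, as in (i): "lengths
differ by a factor of `√2`"). [claim: Mochizuki2012, status: disputed] -/
def Prop15iii_metric [Fintype V] : Prop :=
  ∀ (J : Type) [Fintype J] (Φ : Decomposition I V J) (B : MI I V →ₗ[ℝ] MI I V →ₗ[ℝ] ℝ),
    IsTensorMetric I V B → ∀ x, dsNormSq Φ x = 2 ^ (Fintype.card I - 1) * B x x

/-- **[IUTchIV] Prop. 1.5 (iii), last assertion (invariance)**: "the tensor product metric on `M_I`,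
the direct sum decomposition of `M_I`, the direct sum metric on `M_I`, and the integral structure
`B_I ⊆ M_I` are preserved by the automorphisms of `M_I` induced by the various primitive automorphisms
of the direct summands `ℂ_v` that appear in the factors `M_i` of the tensor product `M_I`" (pp. 15–16).
[claim: Mochizuki2012, status: disputed] -/
def Prop15iii_preserved [Fintype V] : Prop :=
  ∀ σ : I → V → (ℂ ≃ₗᵢ[ℝ] ℂ), (∀ i v, IsPrimitive (σ i v)) →
    (∀ B, IsTensorMetric I V B → ∀ x y, B (induced I V σ x) (induced I V σ y) = B x y) ∧
    ∀ (J : Type) [Fintype J] (Φ : Decomposition I V J),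
      PreservesDecomposition Φ (induced I V σ) ∧
      (∀ x, dsNormSq Φ (induced I V σ x) = dsNormSq Φ x) ∧
      induced I V σ '' ball Φ = ball Φ

open Pointwise in
/-- **[IUTchIV] Prop. 1.5 (iv) (Tensor Product of Vectors of a Given Length)**: "Fix `λ ∈ ℝ_{>0}`.
Then `M_I ∋ ⊗_{i∈I} m_i ∈ λ^{|I|}·B_I` for any collection of elements `{m_i ∈ M_i}_{i∈I}` such that the
component of `m_i` in each direct summand `ℂ_v` of `M_i` is of length `λ`" (p. 16) — for every direct
sum decomposition (they all have the same `B_I`, by uniqueness). PROVED below (`prop15iv_holds`).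
[claim: Mochizuki2012, status: disputed] -/
def Prop15iv : Prop :=
  ∀ (J : Type) [Fintype J] (Φ : Decomposition I V J) (r : ℝ), 0 < r →
    ∀ m : I → M V, (∀ i v, ‖m i v‖ = r) → tprod ℝ m ∈ r ^ Fintype.card I • ball Φ

end Prop15iii

end Literature.IUT.LogVolume

end
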